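import Literature.NumberTheory.Automorphic.BrandtEichlerLevelUOperators
import Literature.NumberTheory.Automorphic.BrandtWeightSymmetry
import HarnessLib

/-!
# `U_ℓ = T(ℓ)` away from the level: the forward filter is vacuous at `ℓ ∤ [O₁ : O]`

Topic `NumberTheory/Automorphic`; theorems only (no definition, no named fact, no instance).
Sequel to `BrandtEichlerLevelUOperators.lean` (definition item
`defn-BrandtEichlerLevelUOperatorsNewQuotient`), proving the first of the two identities that file
records for orientation but leaves unproved (module docstring, "Design notes: `ℓ ∤ N⁺` gives
`T(ℓ)`" and "`uMatrix O O₁ O₂ ℓ = Brandt.matrix O ℓ` there (in particular `U_q = W_q` at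
`q ∣ N⁻`) … NOT proved in this file"):

  **for `ℓ ≥ 2` coprime to an integer `N` with `N O₁ ⊆ O ⊆ O₂`, every sub-lattice of index `ℓ²`
  of a full right `O`-lattice is forward, so `Brandt.uMatrix O O₁ O₂ ℓ = Brandt.matrix O ℓ`**

(`Brandt.isForward_of_coprime`, `Brandt.uMatrix_eq_matrix_of_coprime`), and for a Brandt setup
`S : XiSetup N⁺ N⁻` with its chosen orientation: `S.uMatrix ℓ = Brandt.matrix S.O ℓ` for every
prime `ℓ ∤ N⁺` (`XiSetup.uMatrix_eq_matrix_of_not_dvd`), whence the Hecke matrix at EVERY prime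
is the forward-filtered matrix, `S.heckeAt p = S.uMatrix p` (`XiSetup.heckeAt_eq_uMatrix`): the
case distinction in `Brandt.heckeAt` is a convenience, not a convention. In the classical
dictionary this is the statement that for `ℓ` prime to the level the double coset
`R̂ˣ diag(1, ℓ)_ℓ R̂ˣ` is all of `{g ∈ R̂ : nrd g ∈ ℓ ℤ̂ˣ}`, i.e. `U_ℓ = T_ℓ` off the level
(Voight (41.1.1): `T(ℓ)` counts ALL right sub-ideals of reduced norm `ℓ · nrd I`; W. Zhang 2014
§3.9: "`T_ℓ`, `(ℓ, N) = 1`, and `U_ℓ` for `ℓ ∣ N`").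

## The argument (global, no localisation)

Let `J ⊆ I` have index `ℓ²` and suppose `J` were not forward: `J · link(O₁, O₂) ⊆ ℓ · I O₁`.
Since `N O₁ ⊆ O ⊆ O₂`, the integer `N` lies in `link(O₁, O₂)` (`Brandt.natCast_mem_link`), so
`x N ∈ ℓ · I O₁` for every `x ∈ J`; multiplying by `N` once more and using `N · I O₁ ⊆ I O ⊆ I`
gives `N² x ∈ ℓ I`. As `gcd(N², ℓ) = 1` and `ℓ x ∈ ℓ I`, Bézout yields `x ∈ ℓ I`, i.e.
`J ⊆ ℓ I ⊆ I`. But `[I : ℓ I] = ℓ⁴` for a full `ℤ`-lattice in a quaternion algebra over `ℚ`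
(`Brandt.relIndex_natCast_smul`), and `ℓ⁴ ∣ [I : J] = ℓ²` is absurd for `ℓ ≥ 2`.

## Contents (namespace `Literature.NumberTheory.Automorphic.Brandt`)

* lattice lemmas over any ring: `sq_zsmul_mem_zsmul_of_mul_link_le`, `mem_zsmul_of_coprime_sq`,
  `le_zsmul_of_mul_link_le`;
* in a quaternion algebra over `ℚ`: `not_le_zsmul_of_relIndex_eq_sq`, `isForward_of_coprime`,
  `subidealsWith_isForward_eq_of_coprime`, `uMatrix_eq_matrix_of_coprime`,
  `heckeAt_eq_uMatrix_of_coprime_level`;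
* for `S : XiSetup N⁺ N⁻`: `XiSetup.uMatrix_eq_matrix_of_coprime`,
  `XiSetup.uMatrix_eq_matrix_of_not_dvd`, `XiSetup.heckeAt_eq_uMatrix`.

## References

* [Voight2021] J. Voight, *Quaternion Algebras*, GTM 288, (41.1.1) (Brandt matrices count all
  sub-ideals of norm `n · nrd I`).
* [WZhang2014] W. Zhang, *Selmer groups and the indivisibility of Heegner points*, Camb. J.
  Math. 2 (2014), §3.9 p. 214 (`𝕋_{N⁺,N⁻}`: `T_ℓ` for `(ℓ, N) = 1`, `U_ℓ` for `ℓ ∣ N`).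
* [BertoliniDarmon2001] M. Bertolini, H. Darmon, in *Mathematics Unlimited*, §4.1 pp. 142–144
  (the `U_p`-correspondence on oriented edges).
-/

noncomputable section

open scoped Pointwise

universe u

namespace Literature.NumberTheory.Automorphic

namespace Brandt

/-! ### Lattice lemmas over an arbitrary ring -/

section General

variable {D : Type u} [Ring D]

/-- If `J · link(O₁, O₂) ⊆ ℓ · (I O₁)` with `N O₁ ⊆ O ⊆ O₂`, `1 ∈ O₁` and `I O ⊆ I`, then
`N² x ∈ ℓ I` for every `x ∈ J` (`N ∈ link`, so `x N = ℓ w` with `w ∈ I O₁`, and `N w ∈ I`). [cite: Voight2021, (41.1.1) (sub-ideal count; lattice bookkeeping)] -/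
theorem sq_zsmul_mem_zsmul_of_mul_link_le {O O₁ O₂ I J : Submodule ℤ D} {N ℓ : ℕ}
    (h1 : (1 : D) ∈ O₁) (hN : ∀ y ∈ O₁, (N : ℤ) • y ∈ O) (hO₂ : O ≤ O₂) (hIO : I * O ≤ I)
    (h : J * link O₁ O₂ ≤ (ℓ : ℤ) • (I * O₁)) {x : D} (hx : x ∈ J) :
    ((N ^ 2 : ℕ) : ℤ) • x ∈ (ℓ : ℤ) • I := by
  have hNlink : (N : D) ∈ link O₁ O₂ := natCast_mem_link h1 fun y hy => hO₂ (hN y hy)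
  have hxN : x * (N : D) ∈ (ℓ : ℤ) • (I * O₁) := h (Submodule.mul_mem_mul hx hNlink)
  obtain ⟨w, hw, hxw⟩ := (Submodule.mem_smul_pointwise_iff_exists _ _ _).mp hxN
  -- `N • w ∈ I` for `w ∈ I O₁`
  have hNw : ∀ w ∈ I * O₁, (N : ℤ) • w ∈ I := by
    intro w hw
    refine Submodule.mul_induction_on hw (fun a ha b hb => ?_) (fun u v hu hv => ?_)
    · rw [← mul_smul_comm]
      exact hIO (Submodule.mul_mem_mul ha (hN b hb))
    · rw [smul_add]
      exact I.add_mem hu hv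
  have key : (N : ℤ) • (x * (N : D)) ∈ (ℓ : ℤ) • I := by
    rw [← hxw, smul_comm]
    exact Submodule.smul_mem_pointwise_smul _ (ℓ : ℤ) I (hNw w hw)
  have hrw : (N : ℤ) • (x * (N : D)) = ((N ^ 2 : ℕ) : ℤ) • x := by
    rw [← Int.cast_natCast (R := D) N, ← zsmul_eq_mul', smul_smul, Nat.cast_pow, sq]
  rwa [hrw] at key

/-- Bézout: if `N² x ∈ ℓ I`, `x ∈ I` and `gcd(N, ℓ) = 1`, then `x ∈ ℓ I`. [cite: Voight2021, (41.1.1) (sub-ideal count; lattice bookkeeping)] -/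
theorem mem_zsmul_of_coprime_sq {I : Submodule ℤ D} {N ℓ : ℕ} (hcop : N.Coprime ℓ) {x : D}
    (hxI : x ∈ I) (hx : ((N ^ 2 : ℕ) : ℤ) • x ∈ (ℓ : ℤ) • I) : x ∈ (ℓ : ℤ) • I := by
  have hcop2 : IsCoprime ((N ^ 2 : ℕ) : ℤ) (ℓ : ℤ) :=
    Nat.isCoprime_iff_coprime.mpr (Nat.Coprime.pow_left 2 hcop)
  obtain ⟨a, b, hab⟩ := hcop2
  have hℓx : (ℓ : ℤ) • x ∈ (ℓ : ℤ) • I := Submodule.smul_mem_pointwise_smul _ _ I hxI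
  have : x = a • (((N ^ 2 : ℕ) : ℤ) • x) + b • ((ℓ : ℤ) • x) := by
    rw [smul_smul, smul_smul, ← add_smul, hab, one_smul]
  rw [this]
  exact ((ℓ : ℤ) • I).add_mem (((ℓ : ℤ) • I).smul_mem a hx) (((ℓ : ℤ) • I).smul_mem b hℓx)

/-- **A non-forward sub-lattice lies in `ℓ I`**: if `J ⊆ I`, `J · link(O₁, O₂) ⊆ ℓ · (I O₁)`,
`N O₁ ⊆ O ⊆ O₂`, `I O ⊆ I` and `gcd(N, ℓ) = 1`, then `J ⊆ ℓ I`. [cite: Voight2021, (41.1.1) (sub-ideal count; lattice bookkeeping)] -/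
theorem le_zsmul_of_mul_link_le {O O₁ O₂ I J : Submodule ℤ D} {N ℓ : ℕ}
    (h1 : (1 : D) ∈ O₁) (hN : ∀ y ∈ O₁, (N : ℤ) • y ∈ O) (hO₂ : O ≤ O₂) (hIO : I * O ≤ I)
    (hJI : J ≤ I) (hcop : N.Coprime ℓ) (h : J * link O₁ O₂ ≤ (ℓ : ℤ) • (I * O₁)) :
    J ≤ (ℓ : ℤ) • I := fun _ hx =>
  mem_zsmul_of_coprime_sq hcop (hJI hx) (sq_zsmul_mem_zsmul_of_mul_link_le h1 hN hO₂ hIO h hx)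

/-- For `I ∈ rightIdeals O` one has `I O ⊆ I` (`O = O_R(I)`). [cite: Voight2021, Def. 16.2.9 (right order; unfolding)] -/
theorem mul_le_of_mem_rightIdeals {O I : Submodule ℤ D} (hI : I ∈ rightIdeals O) : I * O ≤ I :=
  Submodule.mul_le.mpr fun m hm x hx => by
    have hx' : x ∈ rightOrder I := by rw [hI.2.1]; exact hx
    exact hx' m hm

end General

/-! ### In a quaternion algebra over `ℚ`: index count and the identity `U_ℓ = T(ℓ)` -/

section Quaternion

variable {D : Type u} [Ring D] [Algebra ℚ D] [IsQuaternionAlgebra ℚ D]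

/-- A sub-lattice of index `ℓ²` (`ℓ ≥ 2`) of a full `ℤ`-lattice `I` in a quaternion algebra over
`ℚ` is NOT contained in `ℓ I` (`[I : ℓ I] = ℓ⁴ > ℓ²`). [cite: Voight2021, (41.1.1) (sub-ideal count; lattice bookkeeping)] -/
theorem not_le_zsmul_of_relIndex_eq_sq {I J : Submodule ℤ D} (hI : IsFullLattice D I) {ℓ : ℕ}
    (hℓ : 2 ≤ ℓ) (hidx : J.toAddSubgroup.relIndex I.toAddSubgroup = ℓ ^ 2) :
    ¬ J ≤ (ℓ : ℤ) • I := by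
  intro hJ
  have hℓ0 : ℓ ≠ 0 := by omega
  obtain ⟨ν, hν, -⟩ := exists_units_val_eq_natCast (D := D) hℓ0
  -- `J ⊆ ν I ⊆ I`
  have hJν : J.toAddSubgroup ≤ (ν • I).toAddSubgroup := by
    intro x hx
    obtain ⟨y, hy, hyx⟩ := (Submodule.mem_smul_pointwise_iff_exists _ _ _).mp (hJ hx)
    have := units_smul_eq_zsmul_of_val_eq hν I hy
    rw [hyx] at this
    exact this
  have hνI : (ν • I).toAddSubgroup ≤ I.toAddSubgroup := by
    intro x hx
    obtain ⟨y, hy, rfl⟩ := exists_eq_zsmul_of_mem_units_smul hν hx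
    exact I.smul_mem _ hy
  have hmul := AddSubgroup.relIndex_mul_relIndex _ _ _ hJν hνI
  rw [relIndex_natCast_smul hI hν, hidx] at hmul
  -- `r * ℓ⁴ = ℓ²` with `r ≠ 0` is impossible for `ℓ ≥ 2`
  have hr : J.toAddSubgroup.relIndex (ν • I).toAddSubgroup ≠ 0 := by
    intro h0
    rw [h0, zero_mul] at hmul
    exact pow_ne_zero 2 hℓ0 hmul.symm
  have h1 : ℓ ^ 4 ≤ ℓ ^ 2 := by
    calc ℓ ^ 4 = 1 * ℓ ^ 4 := (one_mul _).symm
      _ ≤ J.toAddSubgroup.relIndex (ν • I).toAddSubgroup * ℓ ^ 4 :=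
          Nat.mul_le_mul_right _ (Nat.one_le_iff_ne_zero.mpr hr)
      _ = ℓ ^ 2 := hmul
  have h2 : ℓ ^ 2 < ℓ ^ 4 := Nat.pow_lt_pow_right (by omega) (by norm_num)
  omega

/-- **Every sub-lattice of index `ℓ²` is forward at `ℓ` prime to the level.** For orders with
`1 ∈ O₁`, `N O₁ ⊆ O ⊆ O₂`, `gcd(N, ℓ) = 1`, `ℓ ≥ 2`, a full lattice `I` with `I O ⊆ I` and
`J ⊆ I` of index `ℓ²`: `IsForward O₁ O₂ ℓ J I` (the forward filter of
`BrandtEichlerLevelUOperators` is vacuous off the level: `U_ℓ = T_ℓ` for `(ℓ, N) = 1`). [cite: WZhang2014, §3.9 p. 214 (`T_ℓ`, `(ℓ, N) = 1`, and `U_ℓ`, `ℓ ∣ N`)] -/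
theorem isForward_of_coprime {O O₁ O₂ I J : Submodule ℤ D} {N ℓ : ℕ}
    (h1 : (1 : D) ∈ O₁) (hN : ∀ y ∈ O₁, (N : ℤ) • y ∈ O) (hO₂ : O ≤ O₂) (hcop : N.Coprime ℓ)
    (hℓ : 2 ≤ ℓ) (hI : IsFullLattice D I) (hIO : I * O ≤ I) (hJI : J ≤ I)
    (hidx : J.toAddSubgroup.relIndex I.toAddSubgroup = ℓ ^ 2) : IsForward O₁ O₂ ℓ J I :=
  fun h => not_le_zsmul_of_relIndex_eq_sq hI hℓ hidx (le_zsmul_of_mul_link_le h1 hN hO₂ hIO hJI hcop h)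

/-- Off the level the forward-filtered Brandt set of a right `O`-ideal `I` is the whole Brandt
set. [cite: Voight2021, (41.1.1)] -/
theorem subidealsWith_isForward_eq_of_coprime {O O₁ O₂ : Submodule ℤ D} {N ℓ : ℕ}
    (h1 : (1 : D) ∈ O₁) (hN : ∀ y ∈ O₁, (N : ℤ) • y ∈ O) (hO₂ : O ≤ O₂) (hcop : N.Coprime ℓ)
    (hℓ : 2 ≤ ℓ) (I' : Submodule ℤ D) {I : Submodule ℤ D} (hI : I ∈ rightIdeals O) :
    subidealsWith (IsForward O₁ O₂ ℓ) ℓ I' I =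
      {J | J ≤ I ∧ J.toAddSubgroup.relIndex I.toAddSubgroup = ℓ ^ 2 ∧ ∃ α : Dˣ, J = α • I'} := by
  ext J
  simp only [mem_subidealsWith_iff, Set.mem_setOf_eq]
  constructor
  · rintro ⟨hle, hidx, -, hα⟩
    exact ⟨hle, hidx, hα⟩
  · rintro ⟨hle, hidx, hα⟩
    exact ⟨hle, hidx, isForward_of_coprime h1 hN hO₂ hcop hℓ hI.1 (mul_le_of_mem_rightIdeals hI)
      hle hidx, hα⟩

/-- **`U_ℓ = T(ℓ)` at `ℓ` prime to the level**: for `1 ∈ O₁`, `N O₁ ⊆ O ⊆ O₂`, `gcd(N, ℓ) = 1`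
and `ℓ ≥ 2`, `Brandt.uMatrix O O₁ O₂ ℓ = Brandt.matrix O ℓ` (intended use: `O = O₁ ∩ O₂` an
Eichler order of level `N`; in particular `U_q = T(q) = W_q` at the primes `q ∣ N⁻` of a definite
setup). [cite: WZhang2014, §3.9 p. 214 (`T_ℓ`, `(ℓ, N) = 1`, and `U_ℓ`, `ℓ ∣ N`)] -/
theorem uMatrix_eq_matrix_of_coprime {O O₁ O₂ : Submodule ℤ D} {N ℓ : ℕ}
    (h1 : (1 : D) ∈ O₁) (hN : ∀ y ∈ O₁, (N : ℤ) • y ∈ O) (hO₂ : O ≤ O₂) (hcop : N.Coprime ℓ)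
    (hℓ : 2 ≤ ℓ) : uMatrix O O₁ O₂ ℓ = matrix O ℓ := by
  ext i j
  rw [uMatrix_apply, matrix, Matrix.of_apply,
    subidealsWith_isForward_eq_of_coprime h1 hN hO₂ hcop hℓ i.rep j.rep_mem]

/-- Off the level the Hecke matrix `heckeAt` is the forward-filtered matrix too: for a prime
`p ∤ N⁺` (and `N⁺ O₁ ⊆ O ⊆ O₂`), `heckeAt O O₁ O₂ N⁺ p = uMatrix O O₁ O₂ p`; at `p ∣ N⁺` this is
its definition. [cite: WZhang2014, §3.9 p. 214 (`T_ℓ`, `(ℓ, N) = 1`, and `U_ℓ`, `ℓ ∣ N`)] -/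
theorem heckeAt_eq_uMatrix_of_coprime_level {O O₁ O₂ : Submodule ℤ D} {Nplus : ℕ}
    (h1 : (1 : D) ∈ O₁) (hN : ∀ y ∈ O₁, (Nplus : ℤ) • y ∈ O) (hO₂ : O ≤ O₂) {p : ℕ}
    (hp : p.Prime) : heckeAt O O₁ O₂ Nplus p = uMatrix O O₁ O₂ p := by
  by_cases h : p ∣ Nplus
  · exact heckeAt_of_dvd O O₁ O₂ h
  · rw [heckeAt_of_not_dvd O O₁ O₂ h,
      uMatrix_eq_matrix_of_coprime h1 hN hO₂ ((Nat.Prime.coprime_iff_not_dvd hp).mpr h).symm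
        hp.two_le]

end Quaternion

/-! ### Brandt setups -/

section Setup

variable {Nplus Nminus : ℕ} (S : XiSetup Nplus Nminus)

/-- **`S.uMatrix ℓ = T(ℓ)` for `ℓ ≥ 2` prime to `N⁺`** (chosen orientation of a Brandt setup;
`N⁺ S.O₁ ⊆ S.O ⊆ S.O₂` by `XiSetup.natCast_smul_mem_O`, `XiSetup.O_le_O₂`). [cite: WZhang2014, §3.9 p. 214 (`T_ℓ`, `(ℓ, N) = 1`, and `U_ℓ`, `ℓ ∣ N`)] -/
theorem XiSetup.uMatrix_eq_matrix_of_coprime {ℓ : ℕ} (hcop : Nplus.Coprime ℓ) (hℓ : 2 ≤ ℓ) :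
    S.uMatrix ℓ = matrix S.O ℓ :=
  Brandt.uMatrix_eq_matrix_of_coprime S.isOrder_O₁.one_mem (fun _ hy => S.natCast_smul_mem_O hy)
    S.O_le_O₂ hcop hℓ

/-- **`S.uMatrix ℓ = T(ℓ)` at every prime `ℓ ∤ N⁺`** (in particular `= W_q` at `q ∣ N⁻`, tree
`BrandtMatrixRamified.lean`). [cite: WZhang2014, §3.9 p. 214 (`T_ℓ`, `(ℓ, N) = 1`, and `U_ℓ`, `ℓ ∣ N`)] -/
theorem XiSetup.uMatrix_eq_matrix_of_not_dvd {ℓ : ℕ} (hℓ : ℓ.Prime) (h : ¬ ℓ ∣ Nplus) :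
    S.uMatrix ℓ = matrix S.O ℓ :=
  S.uMatrix_eq_matrix_of_coprime ((Nat.Prime.coprime_iff_not_dvd hℓ).mpr h).symm hℓ.two_le

/-- **The Hecke matrix of a setup at ANY prime is the forward-filtered matrix**:
`S.heckeAt p = S.uMatrix p` (`p ∣ N⁺`: by definition; `p ∤ N⁺`: `U_p = T(p)`). [cite: WZhang2014, §3.9 p. 214 (`T_ℓ`, `(ℓ, N) = 1`, and `U_ℓ`, `ℓ ∣ N`)] -/
theorem XiSetup.heckeAt_eq_uMatrix {p : ℕ} (hp : p.Prime) : S.heckeAt p = S.uMatrix p :=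
  Brandt.heckeAt_eq_uMatrix_of_coprime_level S.isOrder_O₁.one_mem
    (fun _ hy => S.natCast_smul_mem_O hy) S.O_le_O₂ hp

end Setup

end Brandt

end Literature.NumberTheory.Automorphic
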